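import Mathlib
import HarnessLib
import Summits.HubbardSuperconductivity.HubbardSuperconductivity.Theorems.KLProgrammeKLRegimeWickBubbleChannelPH
import Summits.HubbardSuperconductivity.HubbardSuperconductivity.Theorems.KLProgrammeKLRegimeWickCarriersDefs
import Summits.HubbardSuperconductivity.HubbardSuperconductivity.Theorems.KLProgrammeKLRegimeWickSecondOrder

/-!
# Route `KLProgramme` — ENGINE child gen 5 (stmt-HubbardSuperconductivity-19918 `KLRegimeEngineV14`), stub `stub_engine_step_values`,
# conjunct (E2-v9): the THREE-CHANNEL READING of the two-line Wick term at the pair labels — assembled vertex-function identity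
# (E2-WICK-ROADMAP §5 (iii-c) step 2, model half, part 3 = the assembly; cell gate-hubbard-kl, seat p1 g9; sequel to `…WickBubbleChannelPH`)

With `Z = (k′↑+, Q−k′↓+, Q−k↓−, k↑−)` the pair labels of `klWickPairAmplitude`, diagonal lines `contr ℂ Cᵢ = diagContr ℓᵢ` (every line of the
step: `contr_klSliceCov/klSoftCov/klHardCov_eq_diagContr`, p499749), `𝒲_n = klWickAction … n`, `𝒱ₘ = vertexFn … m`, `Σ^W = klWickSelfEnergy`:

* §1 two-leg selection (`kernel 𝒲_n 2` pairs only reciprocal labels), leg swaps in degrees `2` and `6`;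
* §2 **`bubbleSum_sixTwo_pairLabels`** — the `𝒲₆⊗𝒲₂` colouring sum: `S₆₂ = 2·(c₆c₂)⁻¹·Σ_{p,σ} ℓ₁(p)ℓ₂(p)·𝒱₆(𝒲_n)(ψ̂⁺_{pσ}, ψ̂⁻_{pσ}, Z)·Σ^W_n(p,σ)`
  (`c₆ = 6!(βL²)⁵`, `c₂ = 2!·βL²`): the six-leg vertex closed on itself through the double line dressed by the Wick self-energy;
* §3 **`vertexFn_dblFold_bubble_pairLabels`** — THE IDENTITY the (E2-v9) prover reads: for two copies of `𝒲_n` and any two diagonal lines,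
  `𝒱₄(dblFold(Δ_×(C₁)Δ_×(C₂)(𝒲_n⁰·𝒲_n¹)))(Z) = 2·(βL²)⁻³·(PP + PHd − PHx − 2·S62)` where
  `PP  = Σ_x λ(x)·K_n(Q)((k⃗,ω₀),x)·K_n(Q)(x,(k⃗′,ω₀))` (`K_n(Q) = klWickPairKernel`, `λ(x) = ℓ₂(p)ℓ₁(p̄) + ℓ₁(p)ℓ₂(p̄)`, `p̄ = (−ω,Q−p⃗)`),
  `PHd = Σ_{p,σ} λ_d·𝒱₄(ψ̂⁻_{pσ},ψ̂⁺_{p+t,σ},Z₀,Z₃)·𝒱₄(ψ̂⁺_{pσ},ψ̂⁻_{p+t,σ},Z₁,Z₂)` (`t = (0,k−k′)`),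
  `PHx = Σ_p Σ_{p′}[cond]·λ_x·𝒱₄(ψ̂⁻_{p↑},ψ̂⁺_{p′↓},Z₀,Z₂)·𝒱₄(ψ̂⁺_{p↑},ψ̂⁻_{p′↓},Z₁,Z₃)` (`cond`: `n(p′)+1 = n(p)`, `p⃗′ = p⃗+Q−k−k′`),
  `S62 = Σ_{p,σ} ℓ₁(p)ℓ₂(p)·𝒱₆(ψ̂⁺_{pσ},ψ̂⁻_{pσ},Z)·Σ^W_n(p,σ)`.
  With the line values `ℓ(p) = w(p)·βL²·ĝ_K(p)` of the step (`w` = cutoff weight) every `λ` carries `(βL²)²`, so each channel is a normalised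
  loop sum `(βL²)⁻¹Σ_p`; the particle–particle one is `−(K·diag z·K)` with `z(x) = −2(βL²)⁻³λ(x)` — the second-order term of the ladder
  `T_K = K(1 + diag z′K)⁻¹` of `pairLadderStepAtV8_of_expansion`.
* §4 **`klw_rung_pairs_vertexFn_pairLabels`** — the instance for the step's actual two-line operator
  `Δ_×(D_n)² − Δ_×(D_{n+1})²` (`klw_rung_pairs`: line pairs `g⊗g + g⊗D + D⊗g`) by bilinearity: the difference of the §3 identities at
  `(D_n, D_n)` and `(D_{n+1}, D_{n+1})`.

Proved; no definitions; exact identities only; nothing about sizes or the model's physics is asserted.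
-/

noncomputable section

namespace Summit.HubbardSuperconductivity.HubbardSuperconductivity.Theorems.KLRegimeWick

set_option linter.dupNamespace false -- summit = problem name (single-conjunct summit), D-0017

open Literature.MathematicalPhysics.QuantumLattice GrassmannAlgebra Finset Matrix
open Literature.Probability.LatticeModels
open Summit.HubbardSuperconductivity.HubbardSuperconductivity.Theorems.TwoPointAssembly
open Summit.HubbardSuperconductivity.HubbardSuperconductivity.Theorems.KLProgrammeLegKernels
open Summit.HubbardSuperconductivity.HubbardSuperconductivity.Theorems.KLRegimeSplit

section Model

variable {L M : ℕ} [NeZero L] [NeZero M] (β U μ : ℝ) (K : TrigPolyC4v)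

/-! ## §1 Two-leg selection; leg swaps in degrees 2 and 6 -/

/-- **Two-leg kernels pair only reciprocal labels** (`ψ̂⁺` first): `kernel 𝒲_n 2 (ψ̂⁺_{pσ}, Y′) = 0` unless `Y′ = ψ̂⁻_{pσ}`. -/
theorem kernel_klWickAction_two_plus_eq_zero (n : ℕ) (p : FreqMomentum L M) (σ : Fin 2) {Y' : HubbardFieldIdx L M}
    (hY : Y' ≠ ((p, σ), 1)) : kernel ℂ (klWickAction L M β U μ K n) 2 ![((p, σ), 0), Y'] = 0 := by
  rcases Y' with ⟨⟨p', σ'⟩, c'⟩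
  by_cases hc : c' = 1
  · subst hc
    by_cases hσ : σ' = σ
    · subst hσ
      by_cases hf : p'.1 = p.1
      · have hm : p'.2 ≠ p.2 := fun h2 => hY (by rw [show p' = p from Prod.ext hf h2])
        have : ∃ j : Fin 2, p'.2 j ≠ p.2 j := by
          by_contra hall
          push Not at hall
          exact hm (funext hall)
        obtain ⟨j, hj⟩ := this
        refine kernel_klWickAction_eq_zero_of_momentum β U μ K n j ?_
        simp only [Fin.sum_univ_two, Matrix.cons_val_zero, Matrix.cons_val_one, Fin.isValue, if_true, one_ne_zero, if_false,
          one_smul, neg_smul]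
        intro h0
        apply hj
        linear_combination -h0
      · refine kernel_klWickAction_eq_zero_of_freq β U μ K n ?_
        simp only [Fin.sum_univ_two, Matrix.cons_val_zero, Matrix.cons_val_one, Fin.isValue, if_true, one_ne_zero, if_false,
          one_mul, neg_mul]
        intro h0
        apply hf
        apply matsubaraInt_injective M
        linarith
    · refine kernel_klWickAction_eq_zero_of_spin β U μ K n ?_
      fin_cases σ <;> fin_cases σ' <;> simp_all [Fin.sum_univ_two]
  · obtain rfl : c' = 0 := by
      rcases Fin.exists_fin_two.mp ⟨c', rfl⟩ with h | h
      · exact h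
      · exact absurd h hc
    refine kernel_klWickAction_eq_zero_of_charge β U μ K n ?_
    simp [Fin.sum_univ_two]

/-- … and (`ψ̂⁻` first): `kernel 𝒲_n 2 (ψ̂⁻_{pσ}, Y′) = 0` unless `Y′ = ψ̂⁺_{pσ}`. -/
theorem kernel_klWickAction_two_minus_eq_zero (n : ℕ) (p : FreqMomentum L M) (σ : Fin 2) {Y' : HubbardFieldIdx L M}
    (hY : Y' ≠ ((p, σ), 0)) : kernel ℂ (klWickAction L M β U μ K n) 2 ![((p, σ), 1), Y'] = 0 := by
  rcases Y' with ⟨⟨p', σ'⟩, c'⟩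
  by_cases hc : c' = 0
  · subst hc
    have h2 : (![((p', σ'), (0 : Fin 2)), ((p, σ), 1)] : Fin 2 → HubbardFieldIdx L M) = ![((p, σ), 1), ((p', σ'), 0)] ∘ Equiv.swap (0 : Fin 2) 1 := by
      funext i; fin_cases i <;> rfl
    have h := kernel_klWickAction_two_plus_eq_zero β U μ K n p' σ' (Y' := ((p, σ), 1)) (fun h => hY (by
      simp only [Prod.mk.injEq] at h
      rw [h.1.1, h.1.2]))
    rw [h2, kernel_comp_perm, Equiv.Perm.sign_swap (by decide)] at h
    simpa using h
  · obtain rfl : c' = 1 := by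
      rcases Fin.exists_fin_two.mp ⟨c', rfl⟩ with h | h
      · exact absurd h hc
      · exact h
    refine kernel_klWickAction_eq_zero_of_charge β U μ K n ?_
    simp [Fin.sum_univ_two]

omit [NeZero L] [NeZero M] in
/-- Leg transposition `0 ↔ 1` negates a `2`-leg kernel. -/
theorem kernel_two_swap01 (W : HubbardGrassmann L M) (A B : HubbardFieldIdx L M) : kernel ℂ W 2 ![B, A] = -kernel ℂ W 2 ![A, B] := by
  have h : (![B, A] : Fin 2 → HubbardFieldIdx L M) = ![A, B] ∘ Equiv.swap (0 : Fin 2) 1 := by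
    funext i; fin_cases i <;> rfl
  rw [h, kernel_comp_perm, Equiv.Perm.sign_swap (by decide)]
  simp

omit [NeZero L] [NeZero M] in
/-- Leg transposition `0 ↔ 1` negates a `6`-leg kernel. -/
theorem kernel_six_swap01 (W : HubbardGrassmann L M) (A B C D E F : HubbardFieldIdx L M) :
    kernel ℂ W 6 ![B, A, C, D, E, F] = -kernel ℂ W 6 ![A, B, C, D, E, F] := by
  have h : (![B, A, C, D, E, F] : Fin 6 → HubbardFieldIdx L M) = ![A, B, C, D, E, F] ∘ Equiv.swap (0 : Fin 6) 1 := by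
    funext i; fin_cases i <;> rfl
  rw [h, kernel_comp_perm, Equiv.Perm.sign_swap (by decide)]
  simp

/-! ## §2 The `𝒲₆ ⊗ 𝒲₂` colouring sum at the pair labels -/

omit [NeZero M] in
/-- `kernel 𝒲 6 X = c₆⁻¹ · 𝒱₆(𝒲)(X)`, `c₆ = 6!(βL²)⁵`. -/
theorem kernel_six_eq_inv_mul_vertexFn (hβ : β ≠ 0) (G : HubbardGrassmann L M) (X : Fin 6 → HubbardFieldIdx L M) :
    kernel ℂ G 6 X = (((Nat.factorial 6 : ℝ) * (β * (L : ℝ) ^ 2) ^ 5 : ℝ) : ℂ)⁻¹ * vertexFn L M β G 6 X := by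
  have hL : (L : ℝ) ≠ 0 := Nat.cast_ne_zero.2 (NeZero.ne L)
  have hc : (((Nat.factorial 6 : ℝ) * (β * (L : ℝ) ^ 2) ^ 5 : ℝ) : ℂ) ≠ 0 := by
    exact_mod_cast mul_ne_zero (by positivity) (pow_ne_zero 5 (mul_ne_zero hβ (pow_ne_zero 2 hL)))
  rw [vertexFn_def, show (6 - 1 : ℕ) = 5 from rfl, ← mul_assoc, inv_mul_cancel₀ hc, one_mul]

omit [NeZero M] in
/-- `kernel 𝒲 2 X = c₂⁻¹ · 𝒱₂(𝒲)(X)`, `c₂ = 2!·βL²`. -/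
theorem kernel_two_eq_inv_mul_vertexFn (hβ : β ≠ 0) (G : HubbardGrassmann L M) (X : Fin 2 → HubbardFieldIdx L M) :
    kernel ℂ G 2 X = (((Nat.factorial 2 : ℝ) * (β * (L : ℝ) ^ 2) ^ 1 : ℝ) : ℂ)⁻¹ * vertexFn L M β G 2 X := by
  have hL : (L : ℝ) ≠ 0 := Nat.cast_ne_zero.2 (NeZero.ne L)
  have hc : (((Nat.factorial 2 : ℝ) * (β * (L : ℝ) ^ 2) ^ 1 : ℝ) : ℂ) ≠ 0 := by
    exact_mod_cast mul_ne_zero (by positivity) (pow_ne_zero 1 (mul_ne_zero hβ (pow_ne_zero 2 hL)))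
  rw [vertexFn_def, show (2 - 1 : ℕ) = 1 from rfl, ← mul_assoc, inv_mul_cancel₀ hc, one_mul]

/-- **`bubbleSum_sixTwo_pairLabels`** — the `𝒲₆⊗𝒲₂` colouring sum of `kernel_dblFold_bubble_self` at any four legs `Z`, for diagonal lines:
`Σ contr C₂ X Y · contr C₁ X' Y' · kernel 𝒲 6 (X,X',Z) · kernel 𝒲 2 (Y,Y') = 2·(c₆c₂)⁻¹·Σ_{p,σ} ℓ₁(p)ℓ₂(p)·𝒱₆(𝒲_n)(ψ̂⁺_{pσ}, ψ̂⁻_{pσ}, Z)·Σ^W_n(p,σ)`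
— both lines sit on the same `(p,σ)` (the two-leg kernel pairs reciprocal labels), the six-leg vertex is closed on itself through the
self-energy-dressed double line. -/
theorem bubbleSum_sixTwo_pairLabels (hβ : β ≠ 0) {C₁ C₂ : Matrix (HubbardFieldIdx L M) (HubbardFieldIdx L M) ℂ}
    {ℓ₁ ℓ₂ : FreqMomentum L M → ℂ} (h₁ : contr ℂ C₁ = diagContr L M ℓ₁) (h₂ : contr ℂ C₂ = diagContr L M ℓ₂) (n : ℕ)
    (Z₀ Z₁ Z₂ Z₃ : HubbardFieldIdx L M) :
    ∑ X, ∑ Y, ∑ X', ∑ Y', contr ℂ C₂ X Y * contr ℂ C₁ X' Y' *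
        (kernel ℂ (klWickAction L M β U μ K n) 6 ![X, X', Z₀, Z₁, Z₂, Z₃] * kernel ℂ (klWickAction L M β U μ K n) 2 ![Y, Y']) =
      2 * ((((Nat.factorial 6 : ℝ) * (β * (L : ℝ) ^ 2) ^ 5 : ℝ) : ℂ)⁻¹ * (((Nat.factorial 2 : ℝ) * (β * (L : ℝ) ^ 2) ^ 1 : ℝ) : ℂ)⁻¹) *
        ∑ p : FreqMomentum L M, ∑ σ : Fin 2, ℓ₁ p * ℓ₂ p *
          (vertexFn L M β (klWickAction L M β U μ K n) 6 ![((p, σ), 0), ((p, σ), 1), Z₀, Z₁, Z₂, Z₃] *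
            klWickSelfEnergy L M β U μ K n p σ) := by
  set W := klWickAction L M β U μ K n with hW
  -- Step 1: line reductions
  rw [h₁, h₂]
  simp_rw [mul_assoc, ← Finset.mul_sum]
  rw [sum_diagContr_mul]
  simp_rw [sum_diagContr_mul]
  -- Step 2: the two-leg kernel pairs only reciprocal labels: equal charges die …
  have hv0 : ∀ (p p' : FreqMomentum L M) (σ σ' : Fin 2), kernel ℂ W 2 ![((p, σ), 0), ((p', σ'), 0)] = 0 :=
    fun p p' σ σ' => kernel_klWickAction_two_plus_eq_zero β U μ K n p σ (by simp)
  have hv1 : ∀ (p p' : FreqMomentum L M) (σ σ' : Fin 2), kernel ℂ W 2 ![((p, σ), 1), ((p', σ'), 1)] = 0 :=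
    fun p p' σ σ' => kernel_klWickAction_two_minus_eq_zero β U μ K n p σ (by simp)
  simp only [hv0, hv1, mul_zero, sub_zero, zero_sub, mul_neg, Finset.sum_neg_distrib, Finset.mul_sum]
  -- … and the second line sits on the same `(p, σ)`
  have hc0 : ∀ (p : FreqMomentum L M) (σ : Fin 2) (g : FreqMomentum L M → Fin 2 → ℂ),
      ∑ p' : FreqMomentum L M, ∑ σ' : Fin 2, g p' σ' * kernel ℂ W 2 ![((p, σ), 0), ((p', σ'), 1)] =
        g p σ * kernel ℂ W 2 ![((p, σ), 0), ((p, σ), 1)] := by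
    intro p σ g
    rw [← Fintype.sum_prod_type']
    refine Finset.sum_eq_single (((p, σ)) : FreqMomentum L M × Fin 2) (fun q _ hq => ?_) (fun h => absurd (Finset.mem_univ _) h)
    obtain ⟨p', σ'⟩ := q
    dsimp only
    rw [kernel_klWickAction_two_plus_eq_zero β U μ K n p σ (fun h => hq (by simpa using h)), mul_zero]
  have hc1 : ∀ (p : FreqMomentum L M) (σ : Fin 2) (g : FreqMomentum L M → Fin 2 → ℂ),
      ∑ p' : FreqMomentum L M, ∑ σ' : Fin 2, g p' σ' * kernel ℂ W 2 ![((p, σ), 1), ((p', σ'), 0)] =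
        g p σ * kernel ℂ W 2 ![((p, σ), 1), ((p, σ), 0)] := by
    intro p σ g
    rw [← Fintype.sum_prod_type']
    refine Finset.sum_eq_single (((p, σ)) : FreqMomentum L M × Fin 2) (fun q _ hq => ?_) (fun h => absurd (Finset.mem_univ _) h)
    obtain ⟨p', σ'⟩ := q
    dsimp only
    rw [kernel_klWickAction_two_minus_eq_zero β U μ K n p σ (fun h => hq (by simpa using h)), mul_zero]
  refine Finset.sum_congr rfl fun p _ => Finset.sum_congr rfl fun σ _ => ?_
  have e0 : ∑ p' : FreqMomentum L M, ∑ σ' : Fin 2, ℓ₁ p' *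
        (kernel ℂ W 6 ![((p, σ), 1), ((p', σ'), 0), Z₀, Z₁, Z₂, Z₃] * kernel ℂ W 2 ![((p, σ), 0), ((p', σ'), 1)]) =
      ℓ₁ p * kernel ℂ W 6 ![((p, σ), 1), ((p, σ), 0), Z₀, Z₁, Z₂, Z₃] * kernel ℂ W 2 ![((p, σ), 0), ((p, σ), 1)] := by
    simp_rw [← mul_assoc]
    exact hc0 p σ (fun p' σ' => ℓ₁ p' * kernel ℂ W 6 ![((p, σ), 1), ((p', σ'), 0), Z₀, Z₁, Z₂, Z₃])
  have e1 : ∑ p' : FreqMomentum L M, ∑ σ' : Fin 2, ℓ₁ p' *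
        (kernel ℂ W 6 ![((p, σ), 0), ((p', σ'), 1), Z₀, Z₁, Z₂, Z₃] * kernel ℂ W 2 ![((p, σ), 1), ((p', σ'), 0)]) =
      ℓ₁ p * kernel ℂ W 6 ![((p, σ), 0), ((p, σ), 1), Z₀, Z₁, Z₂, Z₃] * kernel ℂ W 2 ![((p, σ), 1), ((p, σ), 0)] := by
    simp_rw [← mul_assoc]
    exact hc1 p σ (fun p' σ' => ℓ₁ p' * kernel ℂ W 6 ![((p, σ), 0), ((p', σ'), 1), Z₀, Z₁, Z₂, Z₃])
  rw [e0, e1, kernel_six_swap01 W ((p, σ), 0) ((p, σ), 1), kernel_two_swap01 W ((p, σ), 0) ((p, σ), 1),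
    kernel_six_eq_inv_mul_vertexFn β hβ W, kernel_two_eq_inv_mul_vertexFn β hβ W]
  simp only [hW, klWickSelfEnergy, selfEnergy]
  ring

/-! ## §3 The assembled identity at the pair labels -/

omit [NeZero L] [NeZero M] in
/-- The factorial constants as multiples of powers of `βL²`. -/
theorem vertexFn_consts_eq (β : ℝ) :
    (((Nat.factorial 4 : ℝ) * (β * (L : ℝ) ^ 2) ^ 3 : ℝ) : ℂ) = 24 * (((β * (L : ℝ) ^ 2 : ℝ) : ℂ)) ^ 3 ∧
    (((Nat.factorial 6 : ℝ) * (β * (L : ℝ) ^ 2) ^ 5 : ℝ) : ℂ) = 720 * (((β * (L : ℝ) ^ 2 : ℝ) : ℂ)) ^ 5 ∧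
    (((Nat.factorial 2 : ℝ) * (β * (L : ℝ) ^ 2) ^ 1 : ℝ) : ℂ) = 2 * (((β * (L : ℝ) ^ 2 : ℝ) : ℂ)) ^ 1 := by
  refine ⟨?_, ?_, ?_⟩ <;> (push_cast; norm_num [Nat.factorial])

/-- **`vertexFn_dblFold_bubble_pairLabels` — the three-channel reading.**  For two copies of the scale-`n` Wick action `𝒲_n` and any two diagonal
lines `C₁, C₂` (values `ℓ₁, ℓ₂`), the quartic vertex function of the folded two-line term at the pair labels `Z = (k′↑+, Q−k′↓+, Q−k↓−, k↑−)` is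
`𝒱₄(dblFold(Δ_×(C₁)(Δ_×(C₂)(𝒲_n⁰·𝒲_n¹))))(Z) = 2·(βL²)⁻³·(PP + PHd − PHx − 2·S62)`:
`PP` the particle–particle loop on the frequency-resolved pair kernel (= `(K·diag λ·K)((k,ω₀),(k′,ω₀))`, `bubbleSum_pp_pairLabels_matrix`),
`PHd` the direct particle–hole loop at transfer `(0, k−k′)`, `PHx` the crossed particle–hole loop at `(2ω₀, k+k′−Q)`, `S62` the `𝒲₆` vertex
closed through the self-energy-dressed double line.  With the step's line values `ℓ = w·βL²·ĝ_K` each `λ` carries `(βL²)²`, so every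
channel is a normalised loop sum `(βL²)⁻¹Σ_p`. -/
theorem vertexFn_dblFold_bubble_pairLabels (hβ : β ≠ 0) {C₁ C₂ : Matrix (HubbardFieldIdx L M) (HubbardFieldIdx L M) ℂ}
    {ℓ₁ ℓ₂ : FreqMomentum L M → ℂ} (h₁ : contr ℂ C₁ = diagContr L M ℓ₁) (h₂ : contr ℂ C₂ = diagContr L M ℓ₂) (n : ℕ) (Q k k' : TorusSite 2 L) :
    vertexFn L M β (dblFold ℂ (grassmannLaplacian ℂ (crossCov ℂ C₁) (grassmannLaplacian ℂ (crossCov ℂ C₂)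
        (dblCopy ℂ 0 (klWickAction L M β U μ K n) * dblCopy ℂ 1 (klWickAction L M β U μ K n))))) 4
        ![(((omega0 M, k'), 0), 0), ((((omega0 M).rev, Q - k'), 1), 0), ((((omega0 M).rev, Q - k), 1), 1), (((omega0 M, k), 0), 1)] =
      2 * ((((β * (L : ℝ) ^ 2 : ℝ) : ℂ)) ^ 3)⁻¹ *
        ((∑ x : TorusSite 2 L × MatsubaraIdx M,
            (ℓ₂ (x.2, x.1) * ℓ₁ (x.2.rev, Q - x.1) + ℓ₁ (x.2, x.1) * ℓ₂ (x.2.rev, Q - x.1)) *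
              (klWickPairKernel L M β U μ K n Q (k, omega0 M) x * klWickPairKernel L M β U μ K n Q x (k', omega0 M))) +
          (∑ p : FreqMomentum L M, ∑ σ : Fin 2,
            (ℓ₂ p * ℓ₁ (p.1, p.2 + k - k') + ℓ₁ p * ℓ₂ (p.1, p.2 + k - k')) *
              (vertexFn L M β (klWickAction L M β U μ K n) 4
                  ![((p, σ), 1), (((p.1, p.2 + k - k'), σ), 0), (((omega0 M, k'), 0), 0), (((omega0 M, k), 0), 1)] *
                vertexFn L M β (klWickAction L M β U μ K n) 4
                  ![((p, σ), 0), (((p.1, p.2 + k - k'), σ), 1), ((((omega0 M).rev, Q - k'), 1), 0), ((((omega0 M).rev, Q - k), 1), 1)])) -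
          (∑ p : FreqMomentum L M, ∑ p' : FreqMomentum L M,
            if matsubaraInt M p'.1 + 1 = matsubaraInt M p.1 ∧ p'.2 = p.2 + Q - k - k' then
              (ℓ₂ p * ℓ₁ p' + ℓ₁ p * ℓ₂ p') *
                (vertexFn L M β (klWickAction L M β U μ K n) 4
                    ![((p, 0), 1), ((p', 1), 0), (((omega0 M, k'), 0), 0), ((((omega0 M).rev, Q - k), 1), 1)] *
                  vertexFn L M β (klWickAction L M β U μ K n) 4
                    ![((p, 0), 0), ((p', 1), 1), ((((omega0 M).rev, Q - k'), 1), 0), (((omega0 M, k), 0), 1)])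
            else 0) -
          2 * ∑ p : FreqMomentum L M, ∑ σ : Fin 2, ℓ₁ p * ℓ₂ p *
            (vertexFn L M β (klWickAction L M β U μ K n) 6
                ![((p, σ), 0), ((p, σ), 1), (((omega0 M, k'), 0), 0), ((((omega0 M).rev, Q - k'), 1), 0), ((((omega0 M).rev, Q - k), 1), 1),
                  (((omega0 M, k), 0), 1)] *
              klWickSelfEnergy L M β U μ K n p σ)) := by
  have hL : (L : ℝ) ≠ 0 := Nat.cast_ne_zero.2 (NeZero.ne L)
  have hb : (((β * (L : ℝ) ^ 2 : ℝ) : ℂ)) ≠ 0 := by exact_mod_cast mul_ne_zero hβ (pow_ne_zero 2 hL)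
  obtain ⟨e4, e6, e2⟩ := vertexFn_consts_eq (L := L) β
  set Z₀ : HubbardFieldIdx L M := (((omega0 M, k'), 0), 0) with hZ₀
  set Z₁ : HubbardFieldIdx L M := ((((omega0 M).rev, Q - k'), 1), 0) with hZ₁
  set Z₂ : HubbardFieldIdx L M := ((((omega0 M).rev, Q - k), 1), 1) with hZ₂
  set Z₃ : HubbardFieldIdx L M := (((omega0 M, k), 0), 1) with hZ₃
  have hv0 : (![Z₀, Z₁, Z₂, Z₃] : Fin 4 → HubbardFieldIdx L M) 0 = Z₀ := rfl
  have hv1 : (![Z₀, Z₁, Z₂, Z₃] : Fin 4 → HubbardFieldIdx L M) 1 = Z₁ := rfl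
  have hv2 : (![Z₀, Z₁, Z₂, Z₃] : Fin 4 → HubbardFieldIdx L M) 2 = Z₂ := rfl
  have hv3 : (![Z₀, Z₁, Z₂, Z₃] : Fin 4 → HubbardFieldIdx L M) 3 = Z₃ := rfl
  rw [vertexFn_def, show (4 - 1 : ℕ) = 3 from rfl,
    kernel_dblFold_bubble_self ℂ C₁ C₂ (klw_wickAction_mem_evenOdd_zero L M β U μ K n) ![Z₀, Z₁, Z₂, Z₃]]
  simp only [hv0, hv1, hv2, hv3]
  rw [hZ₀, hZ₁, hZ₂, hZ₃, bubbleSum_pp_pairLabels β U μ K hβ h₁ h₂ n Q k k', bubbleSum_phDirect_pairLabels β U μ K hβ h₁ h₂ n Q k k',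
    bubbleSum_phCrossed_pairLabels β U μ K hβ h₁ h₂ n Q k k', bubbleSum_sixTwo_pairLabels β U μ K hβ h₁ h₂ n, e4, e6, e2]
  field_simp
  ring

/-! ## §4 The step's two-line operator `Δ_×(D_n)² − Δ_×(D_{n+1})²` (line pairs `g⊗g + g⊗D + D⊗g`, `klw_rung_pairs`) -/

omit [NeZero M] in
/-- Bilinearity: the vertex functions of `dblFold((Δ_×(C)² − Δ_×(C′)²) P)` are differences of the two pure ones. -/
theorem vertexFn_dblFold_sq_sub_sq (C C' : Matrix (HubbardFieldIdx L M) (HubbardFieldIdx L M) ℂ)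
    (P : GrassmannAlgebra ℂ (HubbardFieldIdx L M × Fin 2)) (m : ℕ) (Z : Fin m → HubbardFieldIdx L M) :
    vertexFn L M β (dblFold ℂ ((grassmannLaplacian ℂ (crossCov ℂ C) ^ 2 - grassmannLaplacian ℂ (crossCov ℂ C') ^ 2) P)) m Z =
      vertexFn L M β (dblFold ℂ (grassmannLaplacian ℂ (crossCov ℂ C) (grassmannLaplacian ℂ (crossCov ℂ C) P))) m Z -
        vertexFn L M β (dblFold ℂ (grassmannLaplacian ℂ (crossCov ℂ C') (grassmannLaplacian ℂ (crossCov ℂ C') P))) m Z := by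
  rw [LinearMap.sub_apply, sq, sq, Module.End.mul_apply, Module.End.mul_apply, map_sub, klw_vertexFn_sub]

/-- **`klw_rung_pairs_vertexFn_pairLabels`** — the step's two-line operator at the pair labels.  By `klw_rung_pairs` (p487051) the two-line part of
`e^{Δ_×(D_n)} − e^{Δ_×(D_{n+1})}` on `𝒲_n⁰·𝒲_n¹` is `½(Δ_×(D_n)² − Δ_×(D_{n+1})²)` = line pairs `g_{n+1}⊗g_{n+1} + g_{n+1}⊗D_{n+1} + D_{n+1}⊗g_{n+1}`;
its quartic vertex function at the pair labels is the DIFFERENCE of the three-channel identities `vertexFn_dblFold_bubble_pairLabels` at the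
diagonal line pairs `(D_n, D_n)` and `(D_{n+1}, D_{n+1})` (`contr_klSoftCov_eq_diagContr … n` / `… (n+1)`): in particular its particle–particle
part is `−(K_n(Q)·diag z·K_n(Q))((k,ω₀),(k′,ω₀))` with the FULL RUNG WEIGHT
`z(x) ∝ d_n(p)d_n(p̄) − d_{n+1}(p)d_{n+1}(p̄) = s(p)s(p̄) + s(p)d_{n+1}(p̄) + d_{n+1}(p)s(p̄)`, `d_m = (1−χ_{Λ_m})βL²ĝ_K`, `s = d_n − d_{n+1}` the
slice-`(n+1)` line value. -/
theorem klw_rung_pairs_vertexFn_pairLabels (n : ℕ) (Q k k' : TorusSite 2 L) :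
    vertexFn L M β (dblFold ℂ ((grassmannLaplacian ℂ (crossCov ℂ (klSoftCov L M β μ K n)) ^ 2 -
        grassmannLaplacian ℂ (crossCov ℂ (klSoftCov L M β μ K (n + 1))) ^ 2)
          (dblCopy ℂ 0 (klWickAction L M β U μ K n) * dblCopy ℂ 1 (klWickAction L M β U μ K n)))) 4
        ![(((omega0 M, k'), 0), 0), ((((omega0 M).rev, Q - k'), 1), 0), ((((omega0 M).rev, Q - k), 1), 1), (((omega0 M, k), 0), 1)] =
      vertexFn L M β (dblFold ℂ (grassmannLaplacian ℂ (crossCov ℂ (klSoftCov L M β μ K n))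
          (grassmannLaplacian ℂ (crossCov ℂ (klSoftCov L M β μ K n))
            (dblCopy ℂ 0 (klWickAction L M β U μ K n) * dblCopy ℂ 1 (klWickAction L M β U μ K n))))) 4
          ![(((omega0 M, k'), 0), 0), ((((omega0 M).rev, Q - k'), 1), 0), ((((omega0 M).rev, Q - k), 1), 1), (((omega0 M, k), 0), 1)] -
        vertexFn L M β (dblFold ℂ (grassmannLaplacian ℂ (crossCov ℂ (klSoftCov L M β μ K (n + 1)))
          (grassmannLaplacian ℂ (crossCov ℂ (klSoftCov L M β μ K (n + 1)))
            (dblCopy ℂ 0 (klWickAction L M β U μ K n) * dblCopy ℂ 1 (klWickAction L M β U μ K n))))) 4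
          ![(((omega0 M, k'), 0), 0), ((((omega0 M).rev, Q - k'), 1), 0), ((((omega0 M).rev, Q - k), 1), 1), (((omega0 M, k), 0), 1)] :=
  vertexFn_dblFold_sq_sub_sq β _ _ _ 4 _

end Model

end Summit.HubbardSuperconductivity.HubbardSuperconductivity.Theorems.KLRegimeWick

end
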